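import Mathlib
import HarnessLib
import Literature.NumberTheory.LFunctions.SiegelWalfiszLiouville

/-!
# Route `IntegerScrew` — the von Mangoldt coupling form IS a diagonal minus a Dirichlet form (PROP. N4)

PIVOT-LAW §13.10, PROP. N4 (HOME/pivot/): for every `M` and every real `c = (c_k)_{1 ≤ k ≤ M}` the coupling form
`B_M(c) = ∑_{m ≥ 1, n ≥ 1, mn ≤ M} Λ(n) n^{-1/2} c_{mn} c_m` (`2 B_M(c) = cᵀ N_M c`) satisfies the EXACT identity

  `2 B_M(c) = ∑_{k ≤ M} (log k + ∑_{n ≤ M/k} Λ(n)/n) c_k² − ∑_{mn ≤ M} Λ(n) (c_{mn} − c_m/√n)²`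

(`two_mul_vonMangoldtCoupling_eq`).  In the variables `g_k = √k·c_k` the subtracted sum is
`∑_{mn ≤ M} (Λ(n)/mn)(g_{mn} − g_m)²`, the DIRICHLET FORM of the reversible random multiplicative walk
«`k → kn` at rate `Λ(n)/n`, `kn → k` at rate `Λ(n)`» on `{1, …, M}` (stationary weights `1/k`), and the
diagonal is its total jump rate `log k + ∑_{n ≤ M/k} Λ(n)/n = log M − γ + ε(M/k)`: conjugated by
`diag(k^{-1/2})`, `N_M = (log M − γ)·I + ℒ_M + ℰ_M` with `ℒ_M` the walk's generator and `ℰ_M` the Mertens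
fluctuation.  Consequences in the tree: LEMMA N (i) `2 B_M(c) ≤ ∑_k (log k + ∑_{n ≤ M/k} Λ(n)/n) c_k²` is the
statement «Dirichlet form ≥ 0» (`two_mul_vonMangoldtCoupling_le_diag`; cf. p377978
`IntegerScrewVonMangoldtCoupling.lean`, which bounds `2|B_M(c)|` by weighted AM–GM); the identity is the
starting point of PROP. N5/N5′ (PIVOT-LAW §13.11–13.12: Conjecture N⁺ is false).  RH-free, elementary
(termwise algebra + the rearrangement `∑_{m ≤ M} ∑_{n ≤ M/m} = ∑_{k ≤ M} ∑_{mn = k}` of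
`Literature.NumberTheory.LFunctions.SiegelWalfiszLiouville.sum_Ioc_sum_divisorsAntidiagonal_eq` +
`∑_{d ∣ k} Λ(d) = log k`).  Nothing here bears on the truth of RH.

References: M. Suzuki, J. Lond. Math. Soc. (2) 108 (2023) 1448–1487 [Suzuki2023] (screw matrices);
PIVOT-LAW §13.10 (the walk).
-/

noncomputable section

-- D-0017: `Summit.<S>.<S>.…` is the designed namespace of a single-problem summit.
set_option linter.dupNamespace false

namespace Summit.RiemannHypothesis.RiemannHypothesis.Theorems.IntegerScrew

open Finset ArithmeticFunction

/-- Termwise algebra: `2·Λ(n) n^{-1/2} a b = Λ(n) a² + (Λ(n)/n) b² − Λ(n) (a − b/√n)²` for `n ≥ 1`. -/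
theorem two_mul_vonMangoldt_div_sqrt_mul_eq {n : ℕ} (hn : 1 ≤ n) (a b : ℝ) :
    2 * (Λ n / Real.sqrt n * (a * b)) =
      Λ n * a ^ 2 + Λ n / n * b ^ 2 - Λ n * (a - b / Real.sqrt n) ^ 2 := by
  have hn0 : (0 : ℝ) < n := by exact_mod_cast hn
  have hs0 : 0 < Real.sqrt n := Real.sqrt_pos.mpr hn0
  have hss : Real.sqrt n ^ 2 = (n : ℝ) := Real.sq_sqrt hn0.le
  have hinv : (1 / Real.sqrt n) ^ 2 = 1 / (n : ℝ) := by rw [div_pow, one_pow, hss]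
  have hexp : Λ n * (a - b / Real.sqrt n) ^ 2 =
      Λ n * a ^ 2 - 2 * (Λ n / Real.sqrt n * (a * b)) + Λ n * b ^ 2 * (1 / Real.sqrt n) ^ 2 := by
    ring
  rw [hexp, hinv]
  field_simp
  ring

/-- The square part rearranged over `k = mn`: `∑_{m ≤ M} ∑_{n ≤ M/m} Λ(n) c_{mn}² = ∑_{k ≤ M} (log k)·c_k²`
(exact). -/
theorem sum_sum_vonMangoldt_mul_sq_eq (M : ℕ) (c : ℕ → ℝ) :
    ∑ m ∈ Icc 1 M, ∑ n ∈ Icc 1 (M / m), Λ n * c (m * n) ^ 2 =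
      ∑ k ∈ Icc 1 M, Real.log k * c k ^ 2 := by
  have hI : ∀ X : ℕ, Icc 1 X = Ioc 0 X := fun X => by ext m; simp only [mem_Icc, mem_Ioc]; omega
  simp_rw [hI]
  rw [← Literature.NumberTheory.LFunctions.SiegelWalfiszLiouville.sum_Ioc_sum_divisorsAntidiagonal_eq
    (fun m n => Λ n * c (m * n) ^ 2) M]
  refine sum_congr rfl fun k hk => ?_
  have hk0 : k ≠ 0 := by have := (mem_Ioc.1 hk).1; omega
  calc ∑ p ∈ k.divisorsAntidiagonal, Λ p.2 * c (p.1 * p.2) ^ 2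
      = ∑ p ∈ k.divisorsAntidiagonal, Λ p.2 * c k ^ 2 := by
        refine sum_congr rfl fun p hp => ?_
        rw [(Nat.mem_divisorsAntidiagonal.1 hp).1]
    _ = (∑ p ∈ k.divisorsAntidiagonal, Λ p.2) * c k ^ 2 := by rw [sum_mul]
    _ = Real.log k * c k ^ 2 := by
        congr 1
        rw [Nat.sum_divisorsAntidiagonal (f := fun _ b => (Λ b : ℝ)), ← vonMangoldt_sum]
        exact Nat.sum_div_divisors k (fun d => (Λ d : ℝ))

/-- **PROP. N4 — the exact Dirichlet-form decomposition of the coupling form** (PIVOT-LAW §13.10):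
`2 B_M(c) = ∑_{k ≤ M} (log k + ∑_{n ≤ M/k} Λ(n)/n)·c_k² − ∑_{m ≤ M} ∑_{n ≤ M/m} Λ(n)·(c_{mn} − c_m/√n)²`. -/
theorem two_mul_vonMangoldtCoupling_eq (M : ℕ) (c : ℕ → ℝ) :
    2 * ∑ m ∈ Icc 1 M, ∑ n ∈ Icc 1 (M / m), Λ n / Real.sqrt n * (c (m * n) * c m) =
      ∑ k ∈ Icc 1 M, (Real.log k + ∑ n ∈ Icc 1 (M / k), Λ n / n) * c k ^ 2 -
        ∑ m ∈ Icc 1 M, ∑ n ∈ Icc 1 (M / m), Λ n * (c (m * n) - c m / Real.sqrt n) ^ 2 := by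
  -- termwise
  have hterm : 2 * ∑ m ∈ Icc 1 M, ∑ n ∈ Icc 1 (M / m), Λ n / Real.sqrt n * (c (m * n) * c m) =
      ∑ m ∈ Icc 1 M, ∑ n ∈ Icc 1 (M / m),
        (Λ n * c (m * n) ^ 2 + Λ n / n * c m ^ 2 - Λ n * (c (m * n) - c m / Real.sqrt n) ^ 2) := by
    rw [mul_sum]
    refine sum_congr rfl fun m _ => ?_
    rw [mul_sum]
    refine sum_congr rfl fun n hn => ?_
    exact two_mul_vonMangoldt_div_sqrt_mul_eq (mem_Icc.1 hn).1 _ _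
  rw [hterm]
  -- split the three parts
  have hsplit : ∑ m ∈ Icc 1 M, ∑ n ∈ Icc 1 (M / m),
        (Λ n * c (m * n) ^ 2 + Λ n / n * c m ^ 2 - Λ n * (c (m * n) - c m / Real.sqrt n) ^ 2) =
      (∑ m ∈ Icc 1 M, ∑ n ∈ Icc 1 (M / m), Λ n * c (m * n) ^ 2) +
        ∑ m ∈ Icc 1 M, (∑ n ∈ Icc 1 (M / m), Λ n / n) * c m ^ 2 -
          ∑ m ∈ Icc 1 M, ∑ n ∈ Icc 1 (M / m), Λ n * (c (m * n) - c m / Real.sqrt n) ^ 2 := by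
    rw [← sum_add_distrib, ← sum_sub_distrib]
    refine sum_congr rfl fun m _ => ?_
    rw [sum_mul, ← sum_add_distrib, ← sum_sub_distrib]
  rw [hsplit, sum_sum_vonMangoldt_mul_sq_eq M c, ← sum_add_distrib]
  congr 1
  refine sum_congr rfl fun k _ => ?_
  ring

/-- **LEMMA N (i) without absolute values, as «Dirichlet form ≥ 0»**:
`2 B_M(c) ≤ ∑_{k ≤ M} (log k + ∑_{n ≤ M/k} Λ(n)/n)·c_k²`. -/
theorem two_mul_vonMangoldtCoupling_le_diag (M : ℕ) (c : ℕ → ℝ) :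
    2 * ∑ m ∈ Icc 1 M, ∑ n ∈ Icc 1 (M / m), Λ n / Real.sqrt n * (c (m * n) * c m) ≤
      ∑ k ∈ Icc 1 M, (Real.log k + ∑ n ∈ Icc 1 (M / k), Λ n / n) * c k ^ 2 := by
  rw [two_mul_vonMangoldtCoupling_eq]
  have h : 0 ≤ ∑ m ∈ Icc 1 M, ∑ n ∈ Icc 1 (M / m), Λ n * (c (m * n) - c m / Real.sqrt n) ^ 2 :=
    sum_nonneg fun m _ => sum_nonneg fun n _ => mul_nonneg vonMangoldt_nonneg (sq_nonneg _)
  linarith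

/-- The Dirichlet form in the walk's variables `g_k = √k·c_k`: for `m, n ≥ 1`,
`Λ(n)(c_{mn} − c_m/√n)² = (Λ(n)/(mn))·(g_{mn} − g_m)²`. -/
theorem vonMangoldt_dirichletForm_term {m n : ℕ} (hm : 1 ≤ m) (hn : 1 ≤ n) (c : ℕ → ℝ) :
    Λ n * (c (m * n) - c m / Real.sqrt n) ^ 2 =
      Λ n / ((m : ℝ) * n) *
        (Real.sqrt ((m * n : ℕ) : ℝ) * c (m * n) - Real.sqrt m * c m) ^ 2 := by
  have hm0 : (0 : ℝ) < m := by exact_mod_cast hm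
  have hn0 : (0 : ℝ) < n := by exact_mod_cast hn
  have hsm : 0 < Real.sqrt m := Real.sqrt_pos.mpr hm0
  have hsn : 0 < Real.sqrt n := Real.sqrt_pos.mpr hn0
  rw [Nat.cast_mul, Real.sqrt_mul hm0.le]
  have hm2 : Real.sqrt m ^ 2 = m := Real.sq_sqrt hm0.le
  have hn2 : Real.sqrt n ^ 2 = n := Real.sq_sqrt hn0.le
  have key : Real.sqrt m * Real.sqrt n * c (m * n) - Real.sqrt m * c m =
      Real.sqrt m * Real.sqrt n * (c (m * n) - c m / Real.sqrt n) := by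
    field_simp
  rw [key, mul_pow, mul_pow, hm2, hn2]
  field_simp

end Summit.RiemannHypothesis.RiemannHypothesis.Theorems.IntegerScrew

end
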